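import Mathlib
import HarnessLib
import Literature.MathematicalPhysics.StatisticalMechanics.Crystallization
import Literature.MathematicalPhysics.StatisticalMechanics.LennardJonesClusters
import Literature.MathematicalPhysics.StatisticalMechanics.MuGSC
import Literature.MathematicalPhysics.StatisticalMechanics.RootEnergy
import Literature.Probability.Process.PointStationaryLaw
import Literature.MathematicalPhysics.StatisticalMechanics.TwoScaleShellSums

/-!
# The chunk floor (`Floor♭`): finite chunks of a hard-core configuration cost at least
`e⋆` per site, up to a boundary term and an arbitrarily small bulk density

Helper for the registered residual `DiscreteBarlowRigidity` (`R⋆`,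
`stmt-AtomisticToContinuum-28120`, route `ChartedPlanarOrder`; text
`Theorems/ChartedPlanarOrderDiscreteBarlowRigidity.lean`, named form
`Theorems/ChartedPlanarOrderRigidityDoor.lean`).  `R⋆` reads

  `c·θ²·#bad_θ(K) ≤ Σ_{x ∈ K} (e_x(S) − e⋆) + C·#bdry_r(K)`

for clean finite chunks `K` of a `δ`-separated `S ⊆ ℝ³`.  At `c = 0` this is the *floor*
`0 ≤ Σ_{x∈K}(e_x(S) − e⋆) + C·#bdry_r(K)`, which is true but of surface-tension type (the far
field of a clean chunk with interior vacuum pockets is only log-summably charged to `bdry_r`).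
The present file proves the *flat* floor, with an extra bulk term `ε·#K` for every `ε > 0`:

* `chunkFloor_of_clusterBound : (∀ N y, y injective → N·e⋆ ≤ E_LJ(y)) → ChunkFloor`, where
  `ChunkFloor = ∀ δ>0 ∀ ε>0 ∃ C≥0 ∃ r>0 ∀ S δ-separated ∀ K ⊆ S finite,
     0 ≤ Σᶠ_{x∈K} (e_x(S) − e⋆) + C·#bdry_r(K) + ε·#K`.
  The hypothesis (finite clusters cost at least `e⋆ = ⨅_Q e(Q)` per particle) is the tree theorem
  `ChargedEnergyGapNegative.card_mul_eStar_le` (`Theorems/ChargedEnergyGap/Negative/Unconditional.lean`);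
  it is taken as a binder here so that THIS module is born `Theses`-free (theses-cone notice of record,
  TREE v1.30): the unconditional `chunkFloor_holds : ChunkFloor` is discharged in the terminal by-name
  leaf `ChartedPlanarOrderDensityDichotomyFloor.lean`, which imports that (Theses-coned) module anyway.

stated DEF-FREE in the currency of `ChartedPlanarOrderRigidityDoor` (`e_x(S) = ½∫ V_LJ‖y−x‖ d(count|S)`,
`e⋆ = ⨅_Q e(Q)`, `bdry_r(K) = {p ∈ K | ∃ y, count|S {y} ≠ 0 ∧ y ∉ K ∧ |p−y| ≤ r}`), so that the
by-name bridge in the node file `ChartedPlanarOrderDensityDichotomy` is `Iff.rfl`.  NO cleanliness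
(two-shell goodness) of `K` is needed.

Proof (all other inputs `Literature`-level): with `R = r := δ + 1 + A/ε` (`A = 250δ⁻³(δ⁻⁶/12+1/6)`) and the
window `W := {y ∈ S | dist(y,K) ≤ R} ⊇ K` (finite), split `count|S = count|W + count|(S∖W)`;
the far part of `2e_x` is `≥ −ε` (two-scale shell sum `sum_abs_lennardJones_le_two_scale` of `Literature…TwoScaleShellSums`, tail
`≤ A·R⁻³ ≤ ε`); the near part summed over `x ∈ K` is `Σ_{W×W} V − Σ_{x∈W∖K}Σ_{y∈W} V ≥ 2·#W·e⋆ − B_δ·#(W∖K)`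
(the cluster-bound hypothesis `N·e⋆ ≤ E_N`, and the crude one-site bound `B_δ = 250δ⁻⁶(δ⁻⁶/12+1/6)`); finally `#(W∖K) ≤ (2R/δ+1)³·#bdry_R(K)` by volume packing of the
fibres (`card_le_of_separated_of_dist_le`).  Hence `C = (|e⋆| + B_δ/2)(2R/δ+1)³`.

Filed by the decomposition cell `decomp-a2c` (lens 2, g21; landed by hand-1 g8) `--supports stmt-AtomisticToContinuum-28120` (helper; imports `Mathlib`, `HarnessLib`, `Literature` only).
-/

noncomputable section

open MeasureTheory Set Metric
open Literature.MathematicalPhysics.StatisticalMechanics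
namespace Summit.AtomisticToContinuum.Crystallization.Theorems.ChartedPlanarOrderChunkFloor

/-- `ℝ³`. -/
abbrev E3 := EuclideanSpace ℝ (Fin 3)

/-- `e⋆ = ⨅_Q e(Q)`, the periodic Lennard-Jones ground-state energy per particle — proof-internal shorthand for the
very term appearing in `ChunkFloor` (and in `ChargedEnergyGapNegative.eStar`, `ChartedPlanarOrderRigidityDoor.eStar`). -/
private def eStar : ℝ := ⨅ Q : PeriodicConfiguration 3, Q.energyPerParticle lennardJones

/-- **The flat chunk floor `Floor♭`** (def-free text over the `RigidityDoor` currency): for every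
separation `δ > 0` and every `ε > 0` there are `C ≥ 0`, `r > 0` such that every finite chunk `K` of a
`δ`-separated `S ⊆ ℝ³` satisfies `0 ≤ Σᶠ_{x∈K}(e_x(S) − e⋆) + C·#bdry_r(K) + ε·#K`. -/
def ChunkFloor : Prop :=
  ∀ δ : ℝ, 0 < δ → ∀ ε : ℝ, 0 < ε → ∃ C : ℝ, 0 ≤ C ∧ ∃ r : ℝ, 0 < r ∧
    ∀ S : Set E3, (∀ x ∈ S, ∀ y ∈ S, x ≠ y → δ ≤ dist x y) →
      ∀ K : Set E3, K ⊆ S → K.Finite →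
        0 ≤ (∑ᶠ x ∈ K, ((∫ y, lennardJones ‖y - x‖ ∂((Measure.count : Measure E3).restrict S)) / 2 -
                ⨅ Q : PeriodicConfiguration 3, Q.energyPerParticle lennardJones)) +
            C * (Set.ncard {p : E3 | p ∈ K ∧ ∃ y : E3,
                  ((Measure.count : Measure E3).restrict S) {y} ≠ 0 ∧ y ∉ K ∧ dist p y ≤ r} : ℝ) +
            ε * (Set.ncard K : ℝ)

/-! ## Counting-measure bookkeeping -/

/-- The Lennard-Jones field about a site is measurable. [folklore] -/
theorem measurable_lj (x : E3) : Measurable fun y : E3 => lennardJones ‖y - x‖ := by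
  have h : Measurable lennardJones := by unfold lennardJones; fun_prop
  exact h.comp (measurable_norm.comp (measurable_id.sub measurable_const))

/-- A `δ`-separated set (`δ > 0`) is countable (disjoint open `δ/2`-balls in a separable space).  Same
statement as the tree's `IsometryAtomsMinimisingLawsCohesive.MeasurableClass.countable_of_sep` /
`MinimiserShells.Negative.Rootedness.countable_of_separated`, reproved privately because those modules have no
olean on the farm snapshot at filing time. [folklore] -/
private theorem countable_of_separated_chunk {δ : ℝ} (hδ : 0 < δ) {S : Set E3}
    (hsep : ∀ x ∈ S, ∀ y ∈ S, x ≠ y → δ ≤ dist x y) : S.Countable := by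
  have hdisj : S.PairwiseDisjoint fun x => ball x (δ / 2) := by
    intro x hx y hy hxy
    refine Set.disjoint_left.2 fun z hzx hzy => ?_
    have h1 : dist z x < δ / 2 := mem_ball.1 hzx
    have h2 : dist z y < δ / 2 := mem_ball.1 hzy
    have h3 := hsep x hx y hy hxy
    linarith [dist_triangle_left x y z]
  exact hdisj.countable_of_isOpen (fun x _ => isOpen_ball) fun x _ => ⟨x, mem_ball_self (half_pos hδ)⟩

/-- Integrability against `count|T` (`T` countable) from absolute summability. [folklore] -/
theorem integrable_count_restrict_of_summable {T : Set E3} (hT : T.Countable) {f : E3 → ℝ}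
    (hf : Measurable f) (hsum : Summable fun z : T => f z) :
    Integrable f ((Measure.count : Measure E3).restrict T) := by
  refine ⟨hf.aestronglyMeasurable, ?_⟩
  have habs : Summable fun z : T => |f z| := hsum.abs
  rw [hasFiniteIntegral_iff_enorm, lintegral_countable _ hT]
  simp only [Measure.count_singleton, mul_one]
  simp_rw [Real.enorm_eq_ofReal_abs]
  rw [← ENNReal.ofReal_tsum_of_nonneg (fun _ => abs_nonneg _) habs]
  exact ENNReal.ofReal_lt_top

/-- On any part `T` of a `δ`-separated `S`, the Lennard-Jones field about any site is
`count|T`-integrable. [folklore] -/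
theorem integrable_lj {δ : ℝ} (hδ : 0 < δ) {S : Set E3}
    (hsep : ∀ x ∈ S, ∀ y ∈ S, x ≠ y → δ ≤ dist x y) {T : Set E3} (hTS : T ⊆ S) (x : E3) :
    Integrable (fun y : E3 => lennardJones ‖y - x‖) ((Measure.count : Measure E3).restrict T) := by
  have hT : UniformlyDiscrete T := ⟨δ, hδ, fun a ha b hb hab => hsep a (hTS ha) b (hTS hb) hab⟩
  refine integrable_count_restrict_of_summable ((countable_of_separated_chunk hδ hsep).mono hTS)
    (measurable_lj x) ?_
  refine (hT.summable_lennardJones x).congr fun y => ?_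
  rw [dist_comm, dist_eq_norm]

/-- **Lower bound without integrability.** If every finite partial sum of `|f|` over `T` is
`≤ B`, then `∫ f d(count|T) ≥ −B` (the Bochner integral is bounded by the lower integral of the
norm, which is the supremum of the finite partial sums). [folklore] -/
theorem neg_le_integral_count_restrict {T : Set E3} (hT : T.Countable) (f : E3 → ℝ) {B : ℝ}
    (hB : 0 ≤ B) (h : ∀ u : Finset E3, (↑u : Set E3) ⊆ T → ∑ z ∈ u, |f z| ≤ B) :
    -B ≤ ∫ z, f z ∂((Measure.count : Measure E3).restrict T) := by
  classical
  have h1 : ‖∫ z, f z ∂((Measure.count : Measure E3).restrict T)‖ ≤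
      (∫⁻ z, ENNReal.ofReal ‖f z‖ ∂((Measure.count : Measure E3).restrict T)).toReal :=
    norm_integral_le_lintegral_norm _
  have h2 : ∫⁻ z, ENNReal.ofReal ‖f z‖ ∂((Measure.count : Measure E3).restrict T) ≤
      ENNReal.ofReal B := by
    rw [lintegral_countable _ hT]
    simp only [Measure.count_singleton, mul_one]
    refine ENNReal.summable.tsum_le_of_sum_le fun t => ?_
    set t' : Finset E3 := t.map (Function.Embedding.subtype _) with ht'
    have ht'T : (↑t' : Set E3) ⊆ T := by
      intro z hz
      rw [Finset.mem_coe, ht', Finset.mem_map] at hz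
      obtain ⟨a, -, rfl⟩ := hz
      exact a.2
    have hsum : ∑ a ∈ t, ENNReal.ofReal ‖f (a : E3)‖ = ∑ z ∈ t', ENNReal.ofReal ‖f z‖ := by
      rw [ht', Finset.sum_map]; rfl
    rw [hsum, ← ENNReal.ofReal_sum_of_nonneg (fun z _ => norm_nonneg _)]
    refine ENNReal.ofReal_le_ofReal ?_
    simpa only [Real.norm_eq_abs] using h t' ht'T
  have h3 : (∫⁻ z, ENNReal.ofReal ‖f z‖ ∂((Measure.count : Measure E3).restrict T)).toReal ≤ B :=
    ENNReal.toReal_le_of_le_ofReal hB h2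
  have h4 : |∫ z, f z ∂((Measure.count : Measure E3).restrict T)| ≤ B := by
    rw [← Real.norm_eq_abs]; exact h1.trans h3
  linarith [neg_abs_le (∫ z, f z ∂((Measure.count : Measure E3).restrict T))]

/-! ## Volume packing of the collar -/

/-- **Fibre count.** If every point of `W ∖ Kf` (a `δ`-separated finite set `W`) lies within `R` of
some point of `Kf`, then `#(W ∖ Kf) ≤ (2R/δ+1)³ · #{p ∈ Kf | some point of W ∖ Kf is within R of p}`.
[folklore] -/
theorem card_sdiff_le_fibre {δ R : ℝ} (hδ : 0 < δ) (hR : 0 ≤ R) (W Kf : Finset E3)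
    (hsep : ∀ x ∈ W, ∀ y ∈ W, x ≠ y → δ ≤ dist x y)
    (hcov : ∀ y ∈ W \ Kf, ∃ x ∈ Kf, dist x y ≤ R) :
    ((W \ Kf).card : ℝ) ≤
      (2 * R / δ + 1) ^ 3 * ((Kf.filter fun p => ∃ y ∈ W \ Kf, dist p y ≤ R).card : ℝ) := by
  classical
  set D := W \ Kf with hD
  set Bd := Kf.filter fun p => ∃ y ∈ D, dist p y ≤ R with hBd
  set fib : E3 → Finset E3 := fun p => D.filter fun y => dist p y ≤ R with hfib
  have hcover : D ⊆ Bd.biUnion fib := by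
    intro y hy
    obtain ⟨x, hxK, hxy⟩ := hcov y hy
    rw [Finset.mem_biUnion]
    refine ⟨x, ?_, ?_⟩
    · rw [hBd, Finset.mem_filter]; exact ⟨hxK, y, hy, hxy⟩
    · rw [hfib, Finset.mem_filter]; exact ⟨hy, hxy⟩
  have hfibcard : ∀ p ∈ Bd, ((fib p).card : ℝ) ≤ (2 * R / δ + 1) ^ 3 := by
    intro p _
    have h := card_le_of_separated_of_dist_le (fib p) p hδ hR
      (fun c hc => by
        rw [hfib, Finset.mem_filter] at hc
        rw [dist_comm]; exact hc.2)
      (fun c hc d hd hcd => by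
        rw [hfib, Finset.mem_filter] at hc hd
        exact hsep c (Finset.mem_sdiff.1 hc.1).1 d (Finset.mem_sdiff.1 hd.1).1 hcd)
    simpa [finrank_euclideanSpace_fin] using h
  calc (D.card : ℝ) ≤ ((Bd.biUnion fib).card : ℝ) := by exact_mod_cast Finset.card_le_card hcover
    _ ≤ ∑ p ∈ Bd, ((fib p).card : ℝ) := by exact_mod_cast Finset.card_biUnion_le
    _ ≤ ∑ p ∈ Bd, (2 * R / δ + 1) ^ 3 := Finset.sum_le_sum hfibcard
    _ = (2 * R / δ + 1) ^ 3 * (Bd.card : ℝ) := by rw [Finset.sum_const, nsmul_eq_mul, mul_comm]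

/-! ## The floor -/

/-- **`Floor♭` holds, given the finite-cluster bound `N·e⋆ ≤ E_LJ(y)`** (tree theorem
`ChargedEnergyGapNegative.card_mul_eStar_le`; kept as a binder so that this module is `Theses`-free). [this work] -/
theorem chunkFloor_of_clusterBound
    (hCB : ∀ (N : ℕ) (y : Fin N → E3), Function.Injective y →
      (N : ℝ) * (⨅ Q : PeriodicConfiguration 3, Q.energyPerParticle lennardJones) ≤ interactionEnergy lennardJones y) :
    ChunkFloor := by
  classical
  intro δ hδ ε hε
  -- constants: tail constant `A`, near-partner bound `Bδ`, radius `R`, boundary constant `C`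
  set A : ℝ := (δ⁻¹ ^ 6 / 12 + 1 / 6) * (250 * δ⁻¹ ^ 3) with hA_def
  have hA : 0 < A := by positivity
  set Bδ : ℝ := (δ⁻¹ ^ 6 / 12 + 1 / 6) * (250 * δ⁻¹ ^ 3 * δ⁻¹ ^ 3) with hBδ_def
  have hBδ : 0 ≤ Bδ := by positivity
  have hAε : 0 < A / ε := div_pos hA hε
  set R : ℝ := δ + 1 + A / ε with hR_def
  have hRδ : δ ≤ R := by linarith
  have hR1 : 1 ≤ R := by linarith
  have hR0 : 0 < R := by linarith
  have hRA : A / ε ≤ R := by linarith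
  set C : ℝ := (|eStar| + Bδ / 2) * (2 * R / δ + 1) ^ 3 with hC_def
  have hC : 0 ≤ C := by positivity
  refine ⟨C, hC, R, hR0, ?_⟩
  intro S hsep K hKS hKfin
  have heStar : (⨅ Q : PeriodicConfiguration 3, Q.energyPerParticle lennardJones) = eStar := rfl
  rw [heStar]
  set μ : Measure E3 := (Measure.count : Measure E3).restrict S with hμ_def
  -- the tail estimate `A·R⁻³ ≤ ε`
  have htailε : (δ⁻¹ ^ 6 / 12 + 1 / 6) * (250 * δ⁻¹ ^ 3 * R⁻¹ ^ 3) ≤ ε := by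
    have h01 : 0 ≤ R⁻¹ := inv_nonneg.2 hR0.le
    have h1' : R⁻¹ ≤ 1 := inv_le_one_of_one_le₀ hR1
    have hR3 : R⁻¹ ^ 3 ≤ R⁻¹ := by
      calc R⁻¹ ^ 3 = R⁻¹ * (R⁻¹ * R⁻¹) := by ring
        _ ≤ R⁻¹ * (1 * 1) := by gcongr
        _ = R⁻¹ := by ring
    have hAR : A * R⁻¹ ≤ ε := by
      rw [← div_eq_mul_inv, div_le_iff₀ hR0]
      calc A = A / ε * ε := by field_simp
        _ ≤ R * ε := by gcongr
        _ = ε * R := mul_comm _ _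
    calc (δ⁻¹ ^ 6 / 12 + 1 / 6) * (250 * δ⁻¹ ^ 3 * R⁻¹ ^ 3) = A * R⁻¹ ^ 3 := by rw [hA_def]; ring
      _ ≤ A * R⁻¹ := by gcongr
      _ ≤ ε := hAR
  -- the window `W ⊇ K` of `S`-points within `R` of `K`, and `K` as a finset
  have hSud : UniformlyDiscrete S := ⟨δ, hδ, hsep⟩
  have hWfin : {y : E3 | y ∈ S ∧ ∃ x ∈ K, dist x y ≤ R}.Finite := by
    refine (hKfin.biUnion (t := fun x => S ∩ closedBall x R)
      fun x _ => hSud.finite_inter_closedBall x R).subset ?_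
    rintro y ⟨hyS, x, hxK, hxy⟩
    exact mem_biUnion hxK ⟨hyS, mem_closedBall.2 (by rwa [dist_comm])⟩
  set W : Finset E3 := hWfin.toFinset with hW_def
  set Kf : Finset E3 := hKfin.toFinset with hKf_def
  have hmemW : ∀ y, y ∈ W ↔ y ∈ S ∧ ∃ x ∈ K, dist x y ≤ R := fun y => by
    rw [hW_def, Finite.mem_toFinset]; rfl
  have hmemKf : ∀ x, x ∈ Kf ↔ x ∈ K := fun x => by rw [hKf_def, Finite.mem_toFinset]
  have hWS : (↑W : Set E3) ⊆ S := fun y hy => ((hmemW y).1 hy).1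
  have hKW : Kf ⊆ W := fun x hx =>
    (hmemW x).2 ⟨hKS ((hmemKf x).1 hx), x, (hmemKf x).1 hx, by rw [dist_self]; exact hR0.le⟩
  have hWsep : ∀ x ∈ W, ∀ y ∈ W, x ≠ y → δ ≤ dist x y := fun x hx y hy hxy =>
    hsep x (hWS hx) y (hWS hy) hxy
  have hfar : ∀ x ∈ K, ∀ y ∈ S \ (↑W : Set E3), R ≤ dist x y := by
    intro x hx y hy
    by_contra hlt
    exact hy.2 (Finset.mem_coe.2 ((hmemW y).2 ⟨hy.1, x, hx, (not_le.1 hlt).le⟩))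
  -- split of the counting measure along the window
  have hsplit : μ = (Measure.count : Measure E3).restrict (↑W : Set E3) +
      (Measure.count : Measure E3).restrict (S \ ↑W) := by
    rw [← Measure.restrict_union' disjoint_sdiff_right W.measurableSet, union_sdiff_cancel hWS]
  -- per site of `K`: `2 e_x(S) ≥ Σ_{y ∈ W} V(x,y) − ε`
  have hsite : ∀ x ∈ K, ∑ y ∈ W, lennardJones (dist x y) - ε ≤ ∫ y, lennardJones ‖y - x‖ ∂μ := by
    intro x hx
    have hi1 : Integrable (fun y : E3 => lennardJones ‖y - x‖)
        ((Measure.count : Measure E3).restrict (↑W : Set E3)) := integrable_lj hδ hsep hWS x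
    have hi2 : Integrable (fun y : E3 => lennardJones ‖y - x‖)
        ((Measure.count : Measure E3).restrict (S \ ↑W)) := integrable_lj hδ hsep sdiff_subset x
    rw [hsplit, integral_add_measure hi1 hi2, integral_count_restrict_coe_finset]
    have hnear : ∑ y ∈ W, lennardJones ‖y - x‖ = ∑ y ∈ W, lennardJones (dist x y) :=
      Finset.sum_congr rfl fun y _ => by rw [dist_comm, dist_eq_norm]
    have htail : -ε ≤ ∫ y, lennardJones ‖y - x‖ ∂((Measure.count : Measure E3).restrict (S \ ↑W)) := by
      refine neg_le_integral_count_restrict ((countable_of_separated_chunk hδ hsep).mono sdiff_subset) _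
        hε.le fun u hu => ?_
      have h1 := sum_abs_lennardJones_le_two_scale u x hδ hRδ
        (fun z hz w hw hzw => hsep z (hu hz).1 w (hu hw).1 hzw) (fun z hz => hfar x hx z (hu hz))
      calc ∑ z ∈ u, |lennardJones ‖z - x‖| = ∑ z ∈ u, |lennardJones (dist x z)| :=
            Finset.sum_congr rfl fun z _ => by rw [dist_comm, dist_eq_norm]
        _ ≤ (δ⁻¹ ^ 6 / 12 + 1 / 6) * (250 * δ⁻¹ ^ 3 * R⁻¹ ^ 3) := h1
        _ ≤ ε := htailε
    rw [hnear]
    linarith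
  -- the double sum over the window is twice a finite-cluster energy, hence `≥ 2·#W·e⋆`
  have hdouble : 2 * ((W.card : ℝ) * eStar) ≤ ∑ x ∈ W, ∑ y ∈ W, lennardJones (dist x y) := by
    set pts : Fin W.card → E3 := fun i => ((W.equivFin.symm i : W) : E3) with hpts
    have hinj : Function.Injective pts := fun i j hij =>
      W.equivFin.symm.injective (Subtype.ext hij)
    have h1 : (W.card : ℝ) * eStar ≤ interactionEnergy lennardJones pts := hCB _ pts hinj
    have h2 : 2 * interactionEnergy lennardJones pts = ∑ i, ∑ k, lennardJones (dist (pts i) (pts k)) :=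
      two_mul_interactionEnergy_eq_sum_sum lennardJones lennardJones_zero pts
    have inner : ∀ p : E3, ∑ k, lennardJones (dist p (pts k)) = ∑ y ∈ W, lennardJones (dist p y) :=
      fun p => by
        rw [Fintype.sum_equiv W.equivFin.symm (fun k => lennardJones (dist p (pts k)))
          (fun y : W => lennardJones (dist p (y : E3))) (fun _ => rfl),
          Finset.sum_coe_sort W (fun y => lennardJones (dist p y))]
    have h3 : ∑ i, ∑ k, lennardJones (dist (pts i) (pts k)) =
        ∑ x ∈ W, ∑ y ∈ W, lennardJones (dist x y) := by
      simp_rw [inner]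
      rw [Fintype.sum_equiv W.equivFin.symm (fun i => ∑ y ∈ W, lennardJones (dist (pts i) y))
        (fun x : W => ∑ y ∈ W, lennardJones (dist (x : E3) y)) (fun _ => rfl),
        Finset.sum_coe_sort W (fun x => ∑ y ∈ W, lennardJones (dist x y))]
    linarith [h1, h2, h3]
  -- crude one-site bound: `Σ_{y ∈ W} V(x,y) ≤ Bδ` for every `x ∈ W`
  have hcrude : ∀ x ∈ W, ∑ y ∈ W, lennardJones (dist x y) ≤ Bδ := by
    intro x hx
    rw [← Finset.add_sum_erase W _ hx, dist_self, lennardJones_zero, zero_add]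
    have h1 := sum_abs_lennardJones_le_two_scale (W.erase x) x hδ le_rfl
      (fun z hz w hw hzw => hWsep z (Finset.mem_of_mem_erase hz) w (Finset.mem_of_mem_erase hw) hzw)
      (fun z hz => hWsep x hx z (Finset.mem_of_mem_erase hz) (Finset.ne_of_mem_erase hz).symm)
    exact (Finset.sum_le_sum fun z _ => le_abs_self _).trans h1
  -- the collar `D = W ∖ K` and its anchor set `Bd ⊆ bdry_R(K)`
  set D : Finset E3 := W \ Kf with hD_def
  set Bd : Finset E3 := Kf.filter fun p => ∃ y ∈ W \ Kf, dist p y ≤ R with hBd_def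
  have hcov : ∀ y ∈ W \ Kf, ∃ x ∈ Kf, dist x y ≤ R := by
    intro y hy
    rw [Finset.mem_sdiff] at hy
    obtain ⟨-, x, hxK, hxy⟩ := (hmemW y).1 hy.1
    exact ⟨x, (hmemKf x).2 hxK, hxy⟩
  have hfib : (D.card : ℝ) ≤ (2 * R / δ + 1) ^ 3 * (Bd.card : ℝ) :=
    card_sdiff_le_fibre hδ hR0.le W Kf hWsep hcov
  have hbdfin : {p : E3 | p ∈ K ∧ ∃ y : E3, μ {y} ≠ 0 ∧ y ∉ K ∧ dist p y ≤ R}.Finite :=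
    hKfin.subset fun p hp => hp.1
  have hBd_le : (Bd.card : ℝ) ≤
      (Set.ncard {p : E3 | p ∈ K ∧ ∃ y : E3, μ {y} ≠ 0 ∧ y ∉ K ∧ dist p y ≤ R} : ℝ) := by
    have hsub : (↑Bd : Set E3) ⊆ {p : E3 | p ∈ K ∧ ∃ y : E3, μ {y} ≠ 0 ∧ y ∉ K ∧ dist p y ≤ R} := by
      intro p hp
      rw [Finset.mem_coe, hBd_def, Finset.mem_filter] at hp
      obtain ⟨hpK, y, hyD, hpy⟩ := hp
      rw [Finset.mem_sdiff] at hyD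
      refine ⟨(hmemKf p).1 hpK, y, ?_, fun hyK => hyD.2 ((hmemKf y).2 hyK), hpy⟩
      exact (Literature.Probability.Process.count_restrict_singleton_ne_zero_iff S y).2 (hWS hyD.1)
    have h := Set.ncard_le_ncard hsub hbdfin
    rw [Set.ncard_coe_finset] at h
    exact_mod_cast h
  -- bookkeeping identities
  have hsumK : ∑ x ∈ Kf, ∑ y ∈ W, lennardJones (dist x y) =
      ∑ x ∈ W, ∑ y ∈ W, lennardJones (dist x y) - ∑ x ∈ D, ∑ y ∈ W, lennardJones (dist x y) := by
    rw [hD_def, ← Finset.sum_sdiff hKW]; ring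
  have hDsum : ∑ x ∈ D, ∑ y ∈ W, lennardJones (dist x y) ≤ Bδ * (D.card : ℝ) := by
    have h := Finset.sum_le_sum fun x (hx : x ∈ D) => hcrude x (Finset.mem_sdiff.1 hx).1
    rw [Finset.sum_const, nsmul_eq_mul] at h
    linarith
  have hcardW : (W.card : ℝ) = Kf.card + D.card := by
    have h := Finset.card_sdiff_add_card_eq_card hKW
    rw [← hD_def] at h
    exact_mod_cast (by omega : W.card = Kf.card + D.card)
  -- the finite-sum inequality
  have hKsum : ∑ x ∈ Kf, ((∫ y, lennardJones ‖y - x‖ ∂μ) / 2 - eStar) ≥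
      (∑ x ∈ Kf, ∑ y ∈ W, lennardJones (dist x y)) / 2 - (ε / 2 + eStar) * (Kf.card : ℝ) := by
    have h1 : ∑ x ∈ Kf, ((∑ y ∈ W, lennardJones (dist x y) - ε) / 2 - eStar) ≤
        ∑ x ∈ Kf, ((∫ y, lennardJones ‖y - x‖ ∂μ) / 2 - eStar) :=
      Finset.sum_le_sum fun x hx => by
        have := hsite x ((hmemKf x).1 hx)
        linarith
    have h2 : ∑ x ∈ Kf, ((∑ y ∈ W, lennardJones (dist x y) - ε) / 2 - eStar) =
        (∑ x ∈ Kf, ∑ y ∈ W, lennardJones (dist x y)) / 2 - (ε / 2 + eStar) * (Kf.card : ℝ) := by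
      rw [Finset.sum_sub_distrib, Finset.sum_const, nsmul_eq_mul, ← Finset.sum_div,
        Finset.sum_sub_distrib, Finset.sum_const, nsmul_eq_mul]
      ring
    linarith
  have hDe : -(|eStar| * (D.card : ℝ)) ≤ eStar * (D.card : ℝ) := by
    have := neg_abs_le eStar
    nlinarith [Nat.cast_nonneg (α := ℝ) D.card]
  have hncard_le : (|eStar| + Bδ / 2) * (D.card : ℝ) ≤
      C * (Set.ncard {p : E3 | p ∈ K ∧ ∃ y : E3, μ {y} ≠ 0 ∧ y ∉ K ∧ dist p y ≤ R} : ℝ) := by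
    rw [hC_def]
    have h0 : 0 ≤ |eStar| + Bδ / 2 := by positivity
    calc (|eStar| + Bδ / 2) * (D.card : ℝ)
        ≤ (|eStar| + Bδ / 2) * ((2 * R / δ + 1) ^ 3 * (Bd.card : ℝ)) :=
          mul_le_mul_of_nonneg_left hfib h0
      _ ≤ (|eStar| + Bδ / 2) * ((2 * R / δ + 1) ^ 3 *
            (Set.ncard {p : E3 | p ∈ K ∧ ∃ y : E3, μ {y} ≠ 0 ∧ y ∉ K ∧ dist p y ≤ R} : ℝ)) := by
          gcongr
      _ = _ := by ring
  -- conclude: a linear combination of the displayed facts (products named as atoms)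
  have hP1 : (ε / 2 + eStar) * (Kf.card : ℝ) = 1 / 2 * (ε * (Kf.card : ℝ)) + eStar * (Kf.card : ℝ) := by
    ring
  have hWe : (W.card : ℝ) * eStar = eStar * (Kf.card : ℝ) + eStar * (D.card : ℝ) := by
    rw [hcardW]; ring
  have hQ : (|eStar| + Bδ / 2) * (D.card : ℝ) = |eStar| * (D.card : ℝ) + 1 / 2 * (Bδ * (D.card : ℝ)) := by
    ring
  rw [finsum_mem_eq_finite_toFinset_sum _ hKfin, Set.ncard_eq_toFinset_card K hKfin, ← hKf_def]
  have hε2 : 0 ≤ ε * (Kf.card : ℝ) := mul_nonneg hε.le (Nat.cast_nonneg _)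
  linarith [hKsum, hsumK, hDsum, hdouble, hWe, hDe, hncard_le, hP1, hQ, hε2]

end Summit.AtomisticToContinuum.Crystallization.Theorems.ChartedPlanarOrderChunkFloor

end
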